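/-
Copyright (c) 2026. All rights reserved.
Released under Apache 2.0 license as described in the file LICENSE.
Authors: abc-iut cell, prover seat abc-iut-w5-d017 (wave 5, gen 6).
-/
import Literature.IUT.LogVolume.UnitLogDyadicPowerCriterion
import HarnessLib

/-!
# The dyadic case `f = 1`, `4 ∣ e` is field-dependent: `√−1`, `2^{1/4}`, and `π⁴ + 2π² + 6 = 0`

Proof-only sequel (theorems, no definitions) of `UnitLogDyadicPowerCriterion.lean` (`f(K/ℚ₂) = 1`:
`∃ u, ‖log₂ u‖ = 1` iff for some `k ≥ 2`, `2^k s = e`, some `y` has `‖1 − y‖ = ‖ϖ‖^s`, `‖1 + y^{2^k}‖ = ‖ϖ‖^{ke}`).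
Three abstract instances over a complete ultrametric normed `ℚ₂`-algebra field `K`:
* **`norm_one_add_sq_ne_of_sq_eq_neg_one`** — `√−1 ∈ K`, every unit principal ⇒ `‖1 + z²‖ ≠ ‖4‖` for EVERY
  `z` (`1 + z² = (z − i)(z + i)`, the factors differ by `2i`; if `‖z − i‖ = ‖2‖` then `(z − i)/2 ≡ 1 ≡ −i`, so
  `‖z + i‖ < ‖2‖`); so the `k = 2` clause never fires: **`norm_unitLog_ne_one_of_sq_eq_neg_one`** — `√−1 ∈ K`,
  `f = 1`, `8 ∤ e` ⇒ `‖log₂ u‖ ≠ 1` for all `u` (`ℚ₂(ζ₈)`; every `e ∈ {4, 12, 20, …}` field containing `√−1`);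
* **`norm_unitLog_ne_one_of_pow_four_eq_two`** — `e = 4`, `f = 1`, `ϖ₀⁴ = 2` for some `ϖ₀ ∈ K` (`ℚ₂(2^{1/4})`)
  ⇒ `‖log₂ u‖ ≠ 1` for all `u`: at `k = 2`, `s = 1`, `1 + y⁴ = 6x² + 2(1 + t⁴) + 4x + 4x³` (`x = y − 1 = ϖ₀t`)
  has norm `‖ϖ‖⁶ ≠ ‖ϖ‖⁸` since `t⁴ ≡ 1 (mod 2)`;
* **`norm_unitLog_one_add_eq_one_of_quartic`** — `π⁴ + 2π² + 6 = 0` for some `π ∈ K` (then `‖π‖⁴ = ‖2‖`) ⇒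
  the unit `1 + π` HAS a unit logarithm: `(1 + π)⁴ + 1 = 4(π³ + π² + π − 1)`, the `k = 2` clause fires.
So among totally ramified quartic `K/ℚ₂` both behaviours occur, and for [IUTchI] Def 3.1 data (`√−1 ∈ F`)
no `v ∣ 2` with `f(v|2) = 1`, `8 ∤ e(v|2)` has a unit with unit `2`-adic logarithm.  Classical (Neukirch,
*Algebraic Number Theory* II (5.5)).  Nothing here is disputed mathematics; no IUT statement is asserted;
nothing bears on [IUTchIII] Cor. 3.12.
-/

noncomputable section

open Metric Set

namespace Literature.IUT.LogVolume

namespace RamificationCriterion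

open Literature.NumberTheory.GaloisRepresentations.Ultrametric

variable {K : Type*} [NontriviallyNormedField K] [instK : NormedAlgebra ℚ_[2] K] [IsUltrametricDist K]
  [ProperSpace K]

/-! ### §1. `√−1 ∈ K`: `−1` is never a square to precision exactly `4` -/

/-- **`√−1 ∈ K`, every unit principal ⇒ `‖1 + z²‖ ≠ ‖ϖ‖^{2e} (= ‖4‖)` for every `z`**: `1 + z² = (z − i)(z + i)`,
`(z + i) − (z − i) = 2i` has norm `‖ϖ‖^e`; the product of norms is `‖z − i‖²` or `‖z − i‖·‖ϖ‖^e` if `‖z − i‖ ≠ ‖ϖ‖^e`,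
and `< ‖ϖ‖^{2e}` if `‖z − i‖ = ‖ϖ‖^e` (`(z − i)/2 ≡ 1 ≡ −i`). [cite: NeukirchANT1999, Ch. II (5.5)] -/
theorem norm_one_add_sq_ne_of_sq_eq_neg_one {ϖ : Kˣ} (hϖ : IsUniformizer ϖ)
    (hprinc : ∀ u : K, ‖u‖ = 1 → IsPrincipal u) {i : K} (hi : i ^ 2 = -1) (z : K) :
    ‖1 + z ^ 2‖ ≠ ‖(ϖ : K)‖ ^ (2 * (absRamificationIdx 2 K : ℤ)) := by
  have hρ0 : 0 < ‖(ϖ : K)‖ := norm_units_pos ϖ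
  set e : ℕ := absRamificationIdx 2 K with he_def
  have h2 : ‖(2 : K)‖ = ‖(ϖ : K)‖ ^ (e : ℤ) := norm_two_eq_zpow hϖ
  have h20 : (2 : K) ≠ 0 := by
    intro h; rw [h, norm_zero] at h2; exact (zpow_pos hρ0 _).ne h2
  have hi1 : ‖i‖ = 1 := by
    have h : ‖i‖ ^ 2 = 1 := by rw [← norm_pow, hi, norm_neg, norm_one]
    exact (pow_eq_one_iff_of_nonneg (norm_nonneg i) two_ne_zero).mp h
  have h2i : ‖2 * i‖ = ‖(ϖ : K)‖ ^ (e : ℤ) := by rw [norm_mul, hi1, mul_one, h2]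
  have hfac : (1 : K) + z ^ 2 = (z - i) * (z + i) := by linear_combination hi
  have hsq : ‖(ϖ : K)‖ ^ (2 * (e : ℤ)) = ‖(ϖ : K)‖ ^ (e : ℤ) * ‖(ϖ : K)‖ ^ (e : ℤ) := by
    rw [← zpow_add₀ hρ0.ne']; congr 1; ring
  rw [hfac, norm_mul, hsq]
  have hB : z + i = (z - i) + 2 * i := by ring
  intro hprod
  rcases lt_trichotomy ‖z - i‖ (‖(ϖ : K)‖ ^ (e : ℤ)) with hlt | heq | hgt
  · -- `‖z − i‖ < ‖2i‖`: `‖z + i‖ = ‖2i‖`, product too small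
    have hplus : ‖z + i‖ = ‖(ϖ : K)‖ ^ (e : ℤ) := by
      rw [hB, IsUltrametricDist.norm_add_eq_max_of_norm_ne_norm (by rw [h2i]; exact hlt.ne), h2i,
        max_eq_right hlt.le]
    rw [hplus] at hprod
    have := mul_lt_mul_of_pos_right hlt (zpow_pos hρ0 (e : ℤ))
    exact this.ne hprod
  · -- `‖z − i‖ = ‖2‖`: `(z − i)/2 ≡ 1 ≡ -i`, so `‖z + i‖ < ‖2‖`
    have hd : ‖(z - i) / 2‖ = 1 := by rw [norm_div, heq, h2, div_self (zpow_pos hρ0 _).ne']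
    have hdP : ‖1 - (z - i) / 2‖ < 1 := hprinc _ hd
    have hiP : ‖1 - i‖ < 1 := hprinc _ hi1
    have hsum : z + i = 2 * (2 + -(1 - (z - i) / 2) + -(1 - i)) := by field_simp; ring
    have hlt2 : ‖(2 : K) + -(1 - (z - i) / 2) + -(1 - i)‖ < 1 := by
      have h2lt : ‖(2 : K)‖ < 1 := by exact_mod_cast norm_prime_lt_one 2 K
      refine (IsUltrametricDist.norm_add_le_max _ _).trans_lt (max_lt ?_ (by rwa [norm_neg]))
      exact (IsUltrametricDist.norm_add_le_max _ _).trans_lt (max_lt h2lt (by rwa [norm_neg]))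
    have hplus : ‖z + i‖ < ‖(ϖ : K)‖ ^ (e : ℤ) := by
      rw [hsum, norm_mul, h2]
      calc ‖(ϖ : K)‖ ^ (e : ℤ) * ‖(2 : K) + -(1 - (z - i) / 2) + -(1 - i)‖
          < ‖(ϖ : K)‖ ^ (e : ℤ) * 1 := mul_lt_mul_of_pos_left hlt2 (zpow_pos hρ0 _)
        _ = ‖(ϖ : K)‖ ^ (e : ℤ) := mul_one _
    rw [heq] at hprod
    exact (mul_lt_mul_of_pos_left hplus (zpow_pos hρ0 (e : ℤ))).ne hprod
  · -- `‖z − i‖ > ‖2i‖`: `‖z + i‖ = ‖z − i‖`, product `‖z − i‖² ≠ ‖2‖²`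
    have hplus : ‖z + i‖ = ‖z - i‖ := by
      rw [hB, IsUltrametricDist.norm_add_eq_max_of_norm_ne_norm (by rw [h2i]; exact hgt.ne'), h2i,
        max_eq_left hgt.le]
    rw [hplus] at hprod
    have := mul_lt_mul'' hgt hgt (zpow_pos hρ0 _).le (zpow_pos hρ0 _).le
    exact this.ne' hprod

/-- **`√−1 ∈ K`, every unit principal, `‖L(y)‖ = 1` ⇒ the criterion fires at some `k ≥ 3`** (so `8 ∣ e`):
the `k = 2` clause `‖1 + y⁴‖ = ‖ϖ‖^{2e}` is excluded by `norm_one_add_sq_ne_of_sq_eq_neg_one` with `z = y²`.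
[cite: NeukirchANT1999, Ch. II (5.5)] -/
theorem exists_pow_three_le_of_sq_eq_neg_one {ϖ : Kˣ} (hϖ : IsUniformizer ϖ)
    (hprinc : ∀ u : K, ‖u‖ = 1 → IsPrincipal u) {i : K} (hi : i ^ 2 = -1) {y : K} (hyP : IsPrincipal y)
    (h1 : ‖logSeries y‖ = 1) :
    ∃ k : ℕ, 3 ≤ k ∧ ∃ s : ℤ, 1 ≤ s ∧ 2 ^ k * s = (absRamificationIdx 2 K : ℤ) ∧
      ‖1 - y‖ = ‖(ϖ : K)‖ ^ s ∧
      ‖1 + y ^ (2 ^ k)‖ = ‖(ϖ : K)‖ ^ ((k : ℤ) * absRamificationIdx 2 K) := by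
  obtain ⟨k, hk, s, hs1, hks, hy, hplus⟩ := exists_pow_of_norm_logSeries_eq_one hϖ hprinc hyP h1
  refine ⟨k, ?_, s, hs1, hks, hy, hplus⟩
  by_contra hk3
  have hk2 : k = 2 := by omega
  subst hk2
  refine norm_one_add_sq_ne_of_sq_eq_neg_one hϖ hprinc hi (y ^ 2) ?_
  rw [← pow_mul, show 2 * 2 = 2 ^ 2 by norm_num, hplus]
  push_cast
  ring

/-- **`√−1 ∈ K`, `f(K/ℚ₂) = 1`, `8 ∤ e(K/ℚ₂)` ⇒ `‖L(y)‖ ≠ 1` for every principal unit `y`.**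
[cite: NeukirchANT1999, Ch. II (5.5)] -/
theorem norm_logSeries_ne_one_of_sq_eq_neg_one (hf : residueDegree 2 K = 1) {i : K} (hi : i ^ 2 = -1)
    (h8 : ¬ 8 ∣ absRamificationIdx 2 K) {y : K} (hyP : IsPrincipal y) : ‖logSeries y‖ ≠ 1 := by
  intro h1
  obtain ⟨ϖ, hϖ⟩ := exists_isUniformizer (F := K)
  obtain ⟨k, hk, s, hs1, hks, -, -⟩ := exists_pow_three_le_of_sq_eq_neg_one hϖ
    (fun _ hu ↦ WildDyadic.isPrincipal_of_residueDegree_eq_one hf hu) hi hyP h1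
  apply h8
  obtain ⟨j, rfl⟩ := Nat.exists_eq_add_of_le hk
  refine ⟨(2 ^ j * s).toNat, ?_⟩
  have hs0 : (0 : ℤ) ≤ 2 ^ j * s := by positivity
  zify
  rw [Int.toNat_of_nonneg hs0, ← hks, pow_add]
  ring

/-- **`√−1 ∈ K`, `f(K/ℚ₂) = 1`, `8 ∤ e(K/ℚ₂)` ⇒ `‖log₂ u‖ ≠ 1` for every `u : K`** (e.g. `ℚ₂(ζ₈)`, every
totally ramified quartic or degree-`12` field containing `√−1`). [cite: NeukirchANT1999, Ch. II (5.5)] -/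
theorem norm_unitLog_ne_one_of_sq_eq_neg_one (hf : residueDegree 2 K = 1) {i : K} (hi : i ^ 2 = -1)
    (h8 : ¬ 8 ∣ absRamificationIdx 2 K) (u : K) : ‖unitLog u‖ ≠ 1 := by
  by_cases hu : ‖u‖ = 1
  · obtain ⟨m, hm0, hmp, hmP⟩ := exists_pow_isPrincipal_not_dvd (p := 2) hu
    rw [unitLog_eq_inv_mul_logSeries 2 hm0 hmP, norm_mul, norm_inv,
      norm_natCast_eq_one_of_not_dvd 2 hmp, inv_one, one_mul]
    exact norm_logSeries_ne_one_of_sq_eq_neg_one hf hi h8 hmP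
  · rw [unitLog_of_norm_ne_one hu, norm_zero]
    exact zero_ne_one

/-- **`√−1 ∈ K`, `f = 1`, `8 ∤ e` ⇒ `log₂(𝒪_K^×)` misses the unit sphere** (census form).
[cite: NeukirchANT1999, Ch. II (5.5)] -/
theorem logUnits_inter_sphere_eq_empty_of_sq_eq_neg_one (hf : residueDegree 2 K = 1) {i : K}
    (hi : i ^ 2 = -1) (h8 : ¬ 8 ∣ absRamificationIdx 2 K) : logUnits K ∩ sphere 0 1 = ∅ := by
  ext z
  simp only [mem_inter_iff, mem_sphere_zero_iff_norm, mem_empty_iff_false, iff_false, not_and]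
  rintro ⟨u, -, rfl⟩
  exact norm_unitLog_ne_one_of_sq_eq_neg_one hf hi h8 u

/-- … so the "second iterate" of `log₂` on units has EMPTY domain there. [cite: NeukirchANT1999, Ch. II (5.5)] -/
theorem unitLog_image_logUnits_inter_sphere_eq_empty_of_sq_eq_neg_one (hf : residueDegree 2 K = 1)
    {i : K} (hi : i ^ 2 = -1) (h8 : ¬ 8 ∣ absRamificationIdx 2 K) :
    unitLog '' (logUnits K ∩ sphere 0 1) = ∅ := by
  rw [logUnits_inter_sphere_eq_empty_of_sq_eq_neg_one hf hi h8, image_empty]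

/-! ### §2. `π⁴ + 2π² + 6 = 0`: the unit `1 + π` has a unit logarithm -/

omit [ProperSpace K] in
/-- If `π⁴ + 2π² + 6 = 0` then `‖π‖⁴ = ‖2‖` (`π⁴ = −2(π² + 3)` with `π² + 3` a unit; `‖π‖ ≥ 1` is absurd).
[cite: NeukirchANT1999, Ch. II (5.5)] -/
theorem norm_pow_four_eq_of_quartic {π : K} (hπ : π ^ 4 + 2 * π ^ 2 + 6 = 0) : ‖π‖ ^ 4 = ‖(2 : K)‖ := by
  have h2lt : ‖(2 : K)‖ < 1 := by exact_mod_cast norm_prime_lt_one 2 K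
  have h3 : ‖(3 : K)‖ = 1 := by exact_mod_cast norm_natCast_eq_one_of_not_dvd 2 (m := 3) (by norm_num)
  have hπ4 : π ^ 4 = -(2 * (π ^ 2 + 3)) := by linear_combination hπ
  have h4 : ‖π‖ ^ 4 = ‖(2 : K)‖ * ‖π ^ 2 + 3‖ := by rw [← norm_pow, hπ4, norm_neg, norm_mul]
  have hπlt : ‖π‖ < 1 := by
    by_contra hge
    rw [not_lt] at hge
    have hp2 : (1 : ℝ) ≤ ‖π‖ ^ 2 := one_le_pow₀ hge
    have hle : ‖π ^ 2 + 3‖ ≤ ‖π‖ ^ 2 :=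
      (IsUltrametricDist.norm_add_le_max _ _).trans (max_le (by rw [norm_pow]) (by rw [h3]; exact hp2))
    have hlt : ‖π‖ ^ 4 < ‖π‖ ^ 4 :=
      calc ‖π‖ ^ 4 = ‖(2 : K)‖ * ‖π ^ 2 + 3‖ := h4
        _ ≤ ‖(2 : K)‖ * ‖π‖ ^ 2 := mul_le_mul_of_nonneg_left hle (norm_nonneg _)
        _ < 1 * ‖π‖ ^ 2 := mul_lt_mul_of_pos_right h2lt (by positivity)
        _ = ‖π‖ ^ 2 := one_mul _
        _ ≤ ‖π‖ ^ 4 := pow_le_pow_right₀ hge (by norm_num)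
    exact lt_irrefl _ hlt
  have hπ2 : ‖π ^ 2‖ < 1 := by rw [norm_pow]; exact pow_lt_one₀ (norm_nonneg _) hπlt two_ne_zero
  have hiso : ‖π ^ 2 + 3‖ = 1 := by
    rw [IsUltrametricDist.norm_add_eq_max_of_norm_ne_norm (by rw [h3]; exact hπ2.ne), h3,
      max_eq_right hπ2.le]
  rw [h4, hiso, mul_one]

omit [ProperSpace K] in
/-- `π⁴ + 2π² + 6 = 0` ⇒ `‖π‖ < 1`. [cite: NeukirchANT1999, Ch. II (5.5)] -/
theorem norm_lt_one_of_quartic {π : K} (hπ : π ^ 4 + 2 * π ^ 2 + 6 = 0) : ‖π‖ < 1 :=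
  (pow_lt_one_iff_of_nonneg (norm_nonneg π) (by norm_num : (4 : ℕ) ≠ 0)).mp
    (by rw [norm_pow_four_eq_of_quartic hπ]; exact_mod_cast norm_prime_lt_one 2 K)

/-- **`π⁴ + 2π² + 6 = 0` ⇒ `‖L(1 + π)‖ = 1`**: the criterion fires at `k = 2` (`‖π‖ = ‖ϖ‖^s`, `4s = e`)
because `(1 + π)⁴ + 1 = 4(π³ + π² + π − 1)` has norm `‖4‖ = ‖ϖ‖^{2e}`. [cite: NeukirchANT1999, Ch. II (5.5)] -/
theorem norm_logSeries_one_add_eq_one_of_quartic {π : K} (hπ : π ^ 4 + 2 * π ^ 2 + 6 = 0) :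
    ‖logSeries (1 + π)‖ = 1 := by
  obtain ⟨ϖ, hϖ⟩ := exists_isUniformizer (F := K)
  have hρ0 : 0 < ‖(ϖ : K)‖ := norm_units_pos ϖ
  set e : ℕ := absRamificationIdx 2 K with he_def
  have h2 : ‖(2 : K)‖ = ‖(ϖ : K)‖ ^ (e : ℤ) := norm_two_eq_zpow hϖ
  have h4n := norm_pow_four_eq_of_quartic hπ
  have hπ0 : π ≠ 0 := by
    intro h; rw [h, norm_zero, zero_pow (by norm_num), h2] at h4n; exact (zpow_pos hρ0 _).ne' h4n.symm
  obtain ⟨s, hs⟩ := hϖ.2 (Units.mk0 π hπ0)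
  rw [Units.val_mk0] at hs
  have hks : 2 ^ 2 * s = (e : ℤ) := by
    have key : ‖(ϖ : K)‖ ^ (2 ^ 2 * s) = ‖(ϖ : K)‖ ^ (e : ℤ) := by
      rw [← h2, ← h4n, hs, ← zpow_natCast, ← zpow_mul]
      congr 1; push_cast; ring
    exact zpow_right_injective₀ hρ0 hϖ.1.ne key
  have hy : ‖1 - (1 + π)‖ = ‖(ϖ : K)‖ ^ s := by rw [sub_add_cancel_left, norm_neg, hs]
  have hid : (1 : K) + (1 + π) ^ (2 ^ 2) = 4 * (π ^ 3 + π ^ 2 + π - 1) := by linear_combination hπ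
  have hsmall : ‖π ^ 3 + π ^ 2 + π‖ < 1 := by
    have hπlt := norm_lt_one_of_quartic hπ
    have hp : ∀ n : ℕ, n ≠ 0 → ‖π ^ n‖ < 1 := fun n hn ↦ by
      rw [norm_pow]; exact pow_lt_one₀ (norm_nonneg _) hπlt hn
    refine (IsUltrametricDist.norm_add_le_max _ _).trans_lt (max_lt ?_ (by simpa using hp 1 one_ne_zero))
    exact (IsUltrametricDist.norm_add_le_max _ _).trans_lt (max_lt (hp 3 (by norm_num)) (hp 2 two_ne_zero))
  have hunit : ‖π ^ 3 + π ^ 2 + π - 1‖ = 1 := by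
    rw [show π ^ 3 + π ^ 2 + π - 1 = -1 + (π ^ 3 + π ^ 2 + π) by ring,
      IsUltrametricDist.norm_add_eq_max_of_norm_ne_norm (by rw [norm_neg, norm_one]; exact hsmall.ne'),
      norm_neg, norm_one, max_eq_left hsmall.le]
  have h4 : ‖(4 : K)‖ = ‖(ϖ : K)‖ ^ (((2 : ℕ) : ℤ) * e) := by
    rw [show (4 : K) = 2 ^ 2 by norm_num, norm_pow, h2, ← zpow_natCast, ← zpow_mul]
    congr 1; push_cast; ring
  have hplus : ‖1 + (1 + π) ^ (2 ^ 2)‖ = ‖(ϖ : K)‖ ^ (((2 : ℕ) : ℤ) * e) := by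
    rw [hid, norm_mul, hunit, mul_one, h4]
  exact norm_logSeries_eq_one_of_pow hϖ hks hy hplus

/-- **`π⁴ + 2π² + 6 = 0` ⇒ `‖log₂(1 + π)‖ = 1`: the unit `1 + π` has a unit `2`-adic logarithm.**
[cite: NeukirchANT1999, Ch. II (5.5)] -/
theorem norm_unitLog_one_add_eq_one_of_quartic {π : K} (hπ : π ^ 4 + 2 * π ^ 2 + 6 = 0) :
    ‖unitLog (1 + π)‖ = 1 := by
  have hyP : IsPrincipal (1 + π) := by
    show ‖1 - (1 + π)‖ < 1
    rw [sub_add_cancel_left, norm_neg]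
    exact norm_lt_one_of_quartic hπ
  rw [unitLog_of_isPrincipal 2 hyP]
  exact norm_logSeries_one_add_eq_one_of_quartic hπ

/-- **A root of `X⁴ + 2X² + 6` in `K` ⇒ some unit of `𝒪_K` has a unit `2`-adic logarithm.**
[cite: NeukirchANT1999, Ch. II (5.5)] -/
theorem exists_norm_unitLog_eq_one_of_quartic (h : ∃ π : K, π ^ 4 + 2 * π ^ 2 + 6 = 0) :
    ∃ u : K, ‖u‖ = 1 ∧ ‖unitLog u‖ = 1 := by
  obtain ⟨π, hπ⟩ := h
  have hyP : IsPrincipal (1 + π) := by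
    show ‖1 - (1 + π)‖ < 1
    rw [sub_add_cancel_left, norm_neg]
    exact norm_lt_one_of_quartic hπ
  exact ⟨1 + π, hyP.norm_eq_one, norm_unitLog_one_add_eq_one_of_quartic hπ⟩

/-- … census form: `log₂(𝒪_K^×)` MEETS the unit sphere. [cite: NeukirchANT1999, Ch. II (5.5)] -/
theorem logUnits_inter_sphere_nonempty_of_quartic (h : ∃ π : K, π ^ 4 + 2 * π ^ 2 + 6 = 0) :
    (logUnits K ∩ sphere 0 1).Nonempty := by
  obtain ⟨u, hu, hlog⟩ := exists_norm_unitLog_eq_one_of_quartic h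
  exact ⟨unitLog u, ⟨u, hu, rfl⟩, mem_sphere_zero_iff_norm.mpr hlog⟩

/-! ### §3. `e = 4`, `f = 1` and `2` a fourth power (`ℚ₂(2^{1/4})`): no unit logarithm is a unit -/

omit instK [IsUltrametricDist K] [ProperSpace K] in
/-- Discreteness: `‖a‖ < 1 ⇒ ‖a‖ ≤ ‖ϖ‖`. [folklore] -/
private theorem norm_le_unif_of_norm_lt_one {ϖ : Kˣ} (hϖ : IsUniformizer ϖ) {a : K} (ha : ‖a‖ < 1) :
    ‖a‖ ≤ ‖(ϖ : K)‖ := by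
  have hρ0 : 0 < ‖(ϖ : K)‖ := norm_units_pos ϖ
  by_cases ha0 : a = 0
  · rw [ha0, norm_zero]; exact hρ0.le
  obtain ⟨j, hj⟩ := hϖ.2 (Units.mk0 a ha0)
  rw [Units.val_mk0] at hj
  rw [hj] at ha ⊢
  have hj1 : 1 ≤ j := by
    have := (zpow_lt_one_iff_right_of_lt_one₀ hρ0 hϖ.1).mp ha; omega
  calc ‖(ϖ : K)‖ ^ j ≤ ‖(ϖ : K)‖ ^ (1 : ℤ) := zpow_le_zpow_right_of_le_one₀ hρ0 hϖ.1.le hj1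
    _ = ‖(ϖ : K)‖ := zpow_one _

/-- **`e = 4`, every unit principal, `ϖ₀⁴ = 2`, `‖1 − y‖ = ‖ϖ‖` ⇒ `‖1 + y⁴‖ = ‖ϖ‖⁶`**: with `x = y − 1 = ϖ₀t`,
`1 + y⁴ = 6x² + (2(1 + t⁴) + 4x + 4x³)` and `‖1 + t⁴‖ ≤ ‖ϖ‖⁴` (`t⁴ ≡ 1 (mod 2)`), so the term `6x²` of
norm `‖ϖ‖⁶` dominates. [cite: NeukirchANT1999, Ch. II (5.5)] -/
theorem norm_one_add_pow_four_of_pow_four_eq_two {ϖ : Kˣ} (hϖ : IsUniformizer ϖ)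
    (he : absRamificationIdx 2 K = 4) (hprinc : ∀ u : K, ‖u‖ = 1 → IsPrincipal u) {ϖ₀ : K}
    (h2 : ϖ₀ ^ 4 = 2) {y : K} (hy : ‖1 - y‖ = ‖(ϖ : K)‖) : ‖1 + y ^ 4‖ = ‖(ϖ : K)‖ ^ 6 := by
  have hρ0 : 0 < ‖(ϖ : K)‖ := norm_units_pos ϖ
  set ρ : ℝ := ‖(ϖ : K)‖ with hρ_def
  have hn2 : ‖(2 : K)‖ = ρ ^ 4 := by
    have := norm_prime_eq_norm_pow 2 K hϖ; rw [he] at this; exact_mod_cast this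
  have h3 : ‖(3 : K)‖ = 1 := by exact_mod_cast norm_natCast_eq_one_of_not_dvd 2 (m := 3) (by norm_num)
  have hϖ₀ : ‖ϖ₀‖ = ρ := by
    have h : ‖ϖ₀‖ ^ 4 = ρ ^ 4 := by rw [← norm_pow, h2, hn2]
    exact (pow_left_inj₀ (norm_nonneg _) hρ0.le (by norm_num)).mp h
  have hϖ₀0 : ϖ₀ ≠ 0 := by intro h; rw [h, norm_zero] at hϖ₀; exact hρ0.ne hϖ₀
  obtain ⟨t, rfl⟩ : ∃ t : K, y = 1 + ϖ₀ * t := ⟨(y - 1) / ϖ₀, by field_simp; ring⟩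
  set x : K := ϖ₀ * t with hx_def
  have hx : ‖x‖ = ρ := by rw [← norm_neg, ← hy]; congr 1; ring
  have ht1 : ‖t‖ = 1 := by
    have h : ‖ϖ₀‖ * ‖t‖ = ρ := by rw [← norm_mul, ← hx_def, hx]
    rw [hϖ₀] at h; nlinarith [hρ0]
  -- `‖1 + t⁴‖ ≤ ρ⁴`
  have hρ1 : ρ < 1 := hϖ.1
  have hρ41 : ρ ^ 4 ≤ ρ := by
    calc ρ ^ 4 ≤ ρ ^ 1 := pow_le_pow_of_le_one hρ0.le hρ1.le (by norm_num)
      _ = ρ := pow_one ρ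
  have hmt : ‖1 - t‖ ≤ ρ := norm_le_unif_of_norm_lt_one hϖ (hprinc t ht1)
  have hpt : ‖1 + t‖ ≤ ρ := by
    rw [show (1 : K) + t = 2 + -(1 - t) by ring]
    exact (IsUltrametricDist.norm_add_le_max _ _).trans (max_le (hn2 ▸ hρ41) (by rwa [norm_neg]))
  have hpt2 : ‖1 + t ^ 2‖ ≤ ρ ^ 2 := by
    rw [show (1 : K) + t ^ 2 = 2 + -((1 - t) * (1 + t)) by ring]
    refine (IsUltrametricDist.norm_add_le_max _ _).trans (max_le ?_ ?_)
    · rw [hn2]; exact pow_le_pow_of_le_one hρ0.le hρ1.le (by norm_num)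
    · rw [norm_neg, norm_mul, pow_two]
      exact mul_le_mul hmt hpt (norm_nonneg _) hρ0.le
  have hpt4 : ‖1 + t ^ 4‖ ≤ ρ ^ 4 := by
    rw [show (1 : K) + t ^ 4 = 2 + -((1 - t) * (1 + t) * (1 + t ^ 2)) by ring]
    refine (IsUltrametricDist.norm_add_le_max _ _).trans (max_le hn2.le ?_)
    rw [norm_neg, norm_mul, norm_mul, show ρ ^ 4 = ρ * ρ * ρ ^ 2 by ring]
    exact mul_le_mul (mul_le_mul hmt hpt (norm_nonneg _) hρ0.le) hpt2 (norm_nonneg _) (by positivity)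
  -- the decomposition `1 + y⁴ = 6x² + (2(1 + t⁴) + 4x + 4x³)`
  have hdec : (1 : K) + (1 + ϖ₀ * t) ^ 4 = 6 * x ^ 2 + (2 * (1 + t ^ 4) + 4 * x + 4 * x ^ 3) := by
    rw [hx_def]
    linear_combination (t ^ 4) * h2
  have hA : ‖(6 : K) * x ^ 2‖ = ρ ^ 6 := by
    rw [norm_mul, show (6 : K) = 2 * 3 by norm_num, norm_mul, hn2, h3, norm_pow, hx]; ring
  have hn4 : ‖(4 : K)‖ = ρ ^ 8 := by rw [show (4 : K) = 2 ^ 2 by norm_num, norm_pow, hn2]; ring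
  have hB : ‖(2 : K) * (1 + t ^ 4) + 4 * x + 4 * x ^ 3‖ ≤ ρ ^ 8 := by
    refine (IsUltrametricDist.norm_add_le_max _ _).trans (max_le ?_ ?_)
    · refine (IsUltrametricDist.norm_add_le_max _ _).trans (max_le ?_ ?_)
      · rw [norm_mul, hn2, show ρ ^ 8 = ρ ^ 4 * ρ ^ 4 by ring]
        exact mul_le_mul_of_nonneg_left hpt4 (by positivity)
      · rw [norm_mul, hn4, hx]
        calc ρ ^ 8 * ρ ≤ ρ ^ 8 * 1 := mul_le_mul_of_nonneg_left hρ1.le (by positivity)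
          _ = ρ ^ 8 := mul_one _
    · rw [norm_mul, hn4, norm_pow, hx]
      calc ρ ^ 8 * ρ ^ 3 ≤ ρ ^ 8 * 1 :=
          mul_le_mul_of_nonneg_left (pow_le_one₀ hρ0.le hρ1.le) (by positivity)
        _ = ρ ^ 8 := mul_one _
  have hlt : ‖(2 : K) * (1 + t ^ 4) + 4 * x + 4 * x ^ 3‖ < ‖(6 : K) * x ^ 2‖ := by
    rw [hA]
    exact hB.trans_lt (pow_lt_pow_right_of_lt_one₀ hρ0 hρ1 (by norm_num))
  rw [hdec, IsUltrametricDist.norm_add_eq_max_of_norm_ne_norm (ne_of_gt hlt), max_eq_left hlt.le, hA]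

/-- **`e(K/ℚ₂) = 4`, `f(K/ℚ₂) = 1`, `ϖ₀⁴ = 2` for some `ϖ₀ ∈ K` ⇒ `‖L(y)‖ ≠ 1` for every principal unit**:
the criterion could only fire at `k = 2`, `s = 1`, where `‖1 + y⁴‖ = ‖ϖ‖⁶ ≠ ‖ϖ‖⁸`.
[cite: NeukirchANT1999, Ch. II (5.5)] -/
theorem norm_logSeries_ne_one_of_pow_four_eq_two (he : absRamificationIdx 2 K = 4)
    (hf : residueDegree 2 K = 1) {ϖ₀ : K} (h2 : ϖ₀ ^ 4 = 2) {y : K} (hyP : IsPrincipal y) :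
    ‖logSeries y‖ ≠ 1 := by
  intro h1
  obtain ⟨ϖ, hϖ⟩ := exists_isUniformizer (F := K)
  have hρ0 : 0 < ‖(ϖ : K)‖ := norm_units_pos ϖ
  have hprinc : ∀ u : K, ‖u‖ = 1 → IsPrincipal u :=
    fun u hu ↦ WildDyadic.isPrincipal_of_residueDegree_eq_one hf hu
  obtain ⟨k, hk, s, hs1, hks, hy, hplus⟩ := exists_pow_of_norm_logSeries_eq_one hϖ hprinc hyP h1
  have h4s : (2 : ℤ) ^ k * s = 4 := by rw [hks, he]; norm_num
  have hk2 : k = 2 := by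
    by_contra hne
    have hk3 : 3 ≤ k := by omega
    have h8 : (8 : ℤ) ≤ 2 ^ k :=
      calc (8 : ℤ) = 2 ^ 3 := by norm_num
        _ ≤ 2 ^ k := pow_le_pow_right₀ (by norm_num) hk3
    nlinarith
  subst hk2
  have hs : s = 1 := by norm_num at h4s; linarith
  subst hs
  rw [zpow_one] at hy
  have h6 := norm_one_add_pow_four_of_pow_four_eq_two hϖ he hprinc h2 hy
  have h8 : ‖1 + y ^ 4‖ = ‖(ϖ : K)‖ ^ 8 := by
    have h := hplus
    rw [he, show (2 : ℕ) ^ 2 = 4 by norm_num] at h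
    rw [h, ← zpow_natCast]
    congr 1
  rw [h6] at h8
  have h68 := pow_right_injective₀ hρ0 hϖ.1.ne h8
  norm_num at h68

/-- **`e(K/ℚ₂) = 4`, `f(K/ℚ₂) = 1`, `ϖ₀⁴ = 2` (e.g. `K = ℚ₂(2^{1/4})`) ⇒ `‖log₂ u‖ ≠ 1` for every `u : K`.**
[cite: NeukirchANT1999, Ch. II (5.5)] -/
theorem norm_unitLog_ne_one_of_pow_four_eq_two (he : absRamificationIdx 2 K = 4)
    (hf : residueDegree 2 K = 1) {ϖ₀ : K} (h2 : ϖ₀ ^ 4 = 2) (u : K) : ‖unitLog u‖ ≠ 1 := by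
  by_cases hu : ‖u‖ = 1
  · obtain ⟨m, hm0, hmp, hmP⟩ := exists_pow_isPrincipal_not_dvd (p := 2) hu
    rw [unitLog_eq_inv_mul_logSeries 2 hm0 hmP, norm_mul, norm_inv,
      norm_natCast_eq_one_of_not_dvd 2 hmp, inv_one, one_mul]
    exact norm_logSeries_ne_one_of_pow_four_eq_two he hf h2 hmP
  · rw [unitLog_of_norm_ne_one hu, norm_zero]
    exact zero_ne_one

/-- … census form: `log₂(𝒪_K^×)` MISSES the unit sphere. [cite: NeukirchANT1999, Ch. II (5.5)] -/
theorem logUnits_inter_sphere_eq_empty_of_pow_four_eq_two (he : absRamificationIdx 2 K = 4)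
    (hf : residueDegree 2 K = 1) {ϖ₀ : K} (h2 : ϖ₀ ^ 4 = 2) : logUnits K ∩ sphere 0 1 = ∅ := by
  ext z
  simp only [mem_inter_iff, mem_sphere_zero_iff_norm, mem_empty_iff_false, iff_false, not_and]
  rintro ⟨u, -, rfl⟩
  exact norm_unitLog_ne_one_of_pow_four_eq_two he hf h2 u

end RamificationCriterion

end Literature.IUT.LogVolume

end
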